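import Summits.AtomisticToContinuum.HydrodynamicLimit.Theses.OneFlightGossipEngine
import HarnessLib

/-!
# `OneFlightGossipEngine.KacPairHeatFlux` (stmt-AtomisticToContinuum-9534)

ONE KAC COLLISION DAMPS THE PAIR HEAT FLUX BY 2/3 AND SPLITS IT EVENLY.

For independent `ℝ³`-valued velocities `x ∼ μ`, `y ∼ μ'` (probability laws with finite third
moments and mean zero) and an independent kick `ω ∼ ν` (probability law carried by the unit
sphere, symmetric under `ω ↦ -ω`, isotropic second moments `∫ ⟪ω,e⟫² dν = ‖e‖²/3`), the
post-collisional velocity `x' = ½(x+y) + ½‖x−y‖ ω` satisfies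
`E[⟪x',e⟫ ‖x'‖²] = (E[⟪x,e⟫ ‖x‖²] + E[⟪y,e⟫ ‖y‖²]) / 3` for every `e`.

The proof is the elementary moment algebra of Maxwell/Kac collisions (Ikenberry–Truesdell 1956,
Kac 1956), organised in three layers of Bochner integrals (no Fubini is needed, the statement is an
iterated integral):

* kick layer: `∫ ⟪V + h ω, e⟫ ‖V + h ω‖² dν(ω) = ⟪V,e⟫ (‖V‖² + (5/3) h²)` — rewrite `‖ω‖ = 1`
  almost everywhere, kill the odd moments with `ν.map (-·) = ν`, and evaluate
  `∫ ⟪ω,a⟫⟪ω,b⟫ dν = ⟪a,b⟫/3` by polarising the isotropy hypothesis;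
* `y` layer and `x` layer: expand the cubic polynomial, integrate term by term (every term is
  dominated by `C (1 + ‖·‖³)`, so the finite third moments make all Bochner integrals honest), and
  use the centring hypotheses through `integral_inner`.

The closing declaration is `kacPairHeatFlux_proof`, whose type is literally the route decl
`Summit.AtomisticToContinuum.HydrodynamicLimit.Theses.OneFlightGossipEngine.KacPairHeatFlux`.

References: E. Ikenberry, C. Truesdell, J. Rational Mech. Anal. 5 (1956) §§4–6 (moments of the
Maxwellian collision operator); M. Kac, Proc. Third Berkeley Symp. (1956) (the Kac caricature).
-/

noncomputable section

namespace Summit.AtomisticToContinuum.HydrodynamicLimit.Theorems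

open MeasureTheory RealInnerProductSpace
open Literature.MathematicalPhysics.KineticTheory
open Summit.AtomisticToContinuum.HydrodynamicLimit.Theses.OneFlightGossipEngine

namespace KacPair

/-! ### Integrability from a finite third moment -/

/-- `t ≤ 1 + t³` for `t ≥ 0`. -/
theorem le_one_add_cube {t : ℝ} (ht : 0 ≤ t) : t ≤ 1 + t ^ 3 := by
  nlinarith [mul_nonneg ht (sq_nonneg (t - 1)), sq_nonneg (t - 1 / 2)]

/-- `t² ≤ 1 + t³` for `t ≥ 0`. -/
theorem sq_le_one_add_cube {t : ℝ} (ht : 0 ≤ t) : t ^ 2 ≤ 1 + t ^ 3 := by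
  nlinarith [mul_nonneg ht (sq_nonneg (t - 1)), sq_nonneg (t - 1 / 2)]

variable {μ : Measure V3}

/-- Domination by `C (1 + ‖x‖³)` gives integrability under a finite measure with finite third
moment. -/
theorem integrable_of_le_cube [IsFiniteMeasure μ] {F : Type*} [NormedAddCommGroup F]
    (h3 : Integrable (fun x : V3 => ‖x‖ ^ 3) μ) {f : V3 → F} (hf : AEStronglyMeasurable f μ)
    (C : ℝ) (hle : ∀ x, ‖f x‖ ≤ C * (1 + ‖x‖ ^ 3)) : Integrable f μ := by
  have hg : Integrable (fun x : V3 => C * (1 + ‖x‖ ^ 3)) μ :=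
    ((integrable_const (1 : ℝ)).fun_add h3).const_mul C
  exact hg.mono' hf (Filter.Eventually.of_forall hle)

/-- The identity is integrable under a finite third moment. -/
theorem integrable_self [IsFiniteMeasure μ] (h3 : Integrable (fun x : V3 => ‖x‖ ^ 3) μ) :
    Integrable (fun x : V3 => x) μ := by
  refine integrable_of_le_cube h3 (by fun_prop : Continuous fun x : V3 => x).aestronglyMeasurable
    1 fun x => ?_
  rw [one_mul]
  exact le_one_add_cube (norm_nonneg x)

/-- `‖x‖²` is integrable under a finite third moment. -/
theorem integrable_norm_sq [IsFiniteMeasure μ] (h3 : Integrable (fun x : V3 => ‖x‖ ^ 3) μ) :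
    Integrable (fun x : V3 => ‖x‖ ^ 2) μ := by
  refine integrable_of_le_cube h3
    (by fun_prop : Continuous fun x : V3 => ‖x‖ ^ 2).aestronglyMeasurable 1 fun x => ?_
  rw [one_mul, Real.norm_eq_abs, abs_of_nonneg (sq_nonneg _)]
  exact sq_le_one_add_cube (norm_nonneg x)

/-- The heat-flux integrand `⟪x,e⟫ ‖x‖²` is integrable under a finite third moment. -/
theorem integrable_inner_mul_norm_sq [IsFiniteMeasure μ]
    (h3 : Integrable (fun x : V3 => ‖x‖ ^ 3) μ) (e : V3) :
    Integrable (fun x : V3 => ⟪x, e⟫ * ‖x‖ ^ 2) μ := by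
  refine integrable_of_le_cube h3
    (by fun_prop : Continuous fun x : V3 => ⟪x, e⟫ * ‖x‖ ^ 2).aestronglyMeasurable ‖e‖
    fun x => ?_
  rw [norm_mul, Real.norm_eq_abs, Real.norm_eq_abs, abs_of_nonneg (sq_nonneg ‖x‖)]
  have h1 : |⟪x, e⟫| ≤ ‖x‖ * ‖e‖ := abs_real_inner_le_norm x e
  have h2 : ‖x‖ ^ 3 ≤ 1 + ‖x‖ ^ 3 := by linarith
  calc |⟪x, e⟫| * ‖x‖ ^ 2 ≤ ‖x‖ * ‖e‖ * ‖x‖ ^ 2 :=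
        mul_le_mul_of_nonneg_right h1 (sq_nonneg _)
    _ = ‖e‖ * ‖x‖ ^ 3 := by ring
    _ ≤ ‖e‖ * (1 + ‖x‖ ^ 3) := mul_le_mul_of_nonneg_left h2 (norm_nonneg _)

/-- `⟪x,e⟫ • x` is integrable under a finite third moment. -/
theorem integrable_inner_smul_self [IsFiniteMeasure μ]
    (h3 : Integrable (fun x : V3 => ‖x‖ ^ 3) μ) (e : V3) :
    Integrable (fun x : V3 => ⟪x, e⟫ • x) μ := by
  refine integrable_of_le_cube h3
    (by fun_prop : Continuous fun x : V3 => ⟪x, e⟫ • x).aestronglyMeasurable ‖e‖ fun x => ?_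
  rw [norm_smul, Real.norm_eq_abs]
  have h1 : |⟪x, e⟫| ≤ ‖x‖ * ‖e‖ := abs_real_inner_le_norm x e
  have h2 : ‖x‖ ^ 2 ≤ 1 + ‖x‖ ^ 3 := sq_le_one_add_cube (norm_nonneg x)
  calc |⟪x, e⟫| * ‖x‖ ≤ ‖x‖ * ‖e‖ * ‖x‖ := mul_le_mul_of_nonneg_right h1 (norm_nonneg _)
    _ = ‖e‖ * ‖x‖ ^ 2 := by ring
    _ ≤ ‖e‖ * (1 + ‖x‖ ^ 3) := mul_le_mul_of_nonneg_left h2 (norm_nonneg _)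

/-! ### The kick layer -/

variable {ν : Measure V3}

/-- A continuous function bounded on the unit sphere is `ν`-integrable when `ν` is a finite measure
carried by the unit sphere. -/
theorem integrable_of_bound_on_sphere [IsFiniteMeasure ν] (hν1 : ∀ᵐ ω ∂ν, ‖ω‖ = 1)
    {f : V3 → ℝ} (hf : Continuous f) (C : ℝ) (hC : ∀ ω : V3, ‖ω‖ = 1 → ‖f ω‖ ≤ C) :
    Integrable f ν :=
  (integrable_const C).mono' hf.aestronglyMeasurable (hν1.mono fun ω hω => hC ω hω)

/-- `ω ↦ ⟪ω,a⟫` is integrable on the sphere. -/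
theorem integrable_inner_left [IsFiniteMeasure ν] (hν1 : ∀ᵐ ω ∂ν, ‖ω‖ = 1) (a : V3) :
    Integrable (fun ω : V3 => ⟪ω, a⟫) ν := by
  refine integrable_of_bound_on_sphere hν1 (by fun_prop) ‖a‖ fun ω hω => ?_
  rw [Real.norm_eq_abs]
  simpa [hω] using abs_real_inner_le_norm ω a

/-- `ω ↦ ⟪ω,a⟫ ⟪ω,b⟫` is integrable on the sphere. -/
theorem integrable_inner_mul_inner [IsFiniteMeasure ν] (hν1 : ∀ᵐ ω ∂ν, ‖ω‖ = 1) (a b : V3) :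
    Integrable (fun ω : V3 => ⟪ω, a⟫ * ⟪ω, b⟫) ν := by
  refine integrable_of_bound_on_sphere hν1 (by fun_prop) (‖a‖ * ‖b‖) fun ω hω => ?_
  rw [norm_mul, Real.norm_eq_abs, Real.norm_eq_abs]
  have ha : |⟪ω, a⟫| ≤ ‖a‖ := by simpa [hω] using abs_real_inner_le_norm ω a
  have hb : |⟪ω, b⟫| ≤ ‖b‖ := by simpa [hω] using abs_real_inner_le_norm ω b
  exact mul_le_mul ha hb (abs_nonneg _) (norm_nonneg _)

/-- `ω ↦ ⟪ω,a⟫²` is integrable on the sphere. -/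
theorem integrable_inner_sq [IsFiniteMeasure ν] (hν1 : ∀ᵐ ω ∂ν, ‖ω‖ = 1) (a : V3) :
    Integrable (fun ω : V3 => ⟪ω, a⟫ ^ 2) ν := by
  simpa [sq] using integrable_inner_mul_inner hν1 a a

/-- Symmetry of the kick law: `∫ f(-ω) dν = ∫ f dν`. -/
theorem integral_comp_neg_eq (hνs : ν.map (fun ω => -ω) = ν) {f : V3 → ℝ} (hf : Continuous f) :
    ∫ ω, f (-ω) ∂ν = ∫ ω, f ω ∂ν := by
  calc ∫ ω, f (-ω) ∂ν = ∫ ω, f ω ∂(ν.map fun ω => -ω) :=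
        (integral_map measurable_neg.aemeasurable hf.aestronglyMeasurable).symm
    _ = ∫ ω, f ω ∂ν := by rw [hνs]

/-- Odd first moments vanish: `∫ ⟪ω,a⟫ dν = 0`. -/
theorem integral_inner_eq_zero (hνs : ν.map (fun ω => -ω) = ν) (a : V3) :
    ∫ ω, ⟪ω, a⟫ ∂ν = 0 := by
  have h := integral_comp_neg_eq hνs (f := fun ω : V3 => ⟪ω, a⟫) (by fun_prop)
  simp only [inner_neg_left, integral_neg] at h
  linarith

/-- Polarised isotropy: `∫ ⟪ω,a⟫ ⟪ω,b⟫ dν = ⟪a,b⟫ / 3`. -/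
theorem integral_inner_mul_inner [IsFiniteMeasure ν] (hν1 : ∀ᵐ ω ∂ν, ‖ω‖ = 1)
    (hνiso : ∀ e : V3, ∫ ω, ⟪ω, e⟫ ^ 2 ∂ν = ‖e‖ ^ 2 / 3) (a b : V3) :
    ∫ ω, ⟪ω, a⟫ * ⟪ω, b⟫ ∂ν = ⟪a, b⟫ / 3 := by
  have hpt : (fun ω : V3 => ⟪ω, a⟫ * ⟪ω, b⟫) =
      fun ω => (⟪ω, a + b⟫ ^ 2 - ⟪ω, a⟫ ^ 2 - ⟪ω, b⟫ ^ 2) / 2 := by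
    funext ω
    rw [inner_add_right]
    ring
  have iab := integrable_inner_sq hν1 (a + b)
  have ia := integrable_inner_sq hν1 a
  have ib := integrable_inner_sq hν1 b
  rw [hpt, integral_div, integral_sub (iab.sub' ia) ib, integral_sub iab ia, hνiso, hνiso, hνiso,
    norm_add_sq_real]
  ring

/-- THE KICK LAYER. For a probability law `ν` on the unit sphere, symmetric and isotropic,
`∫ ⟪V + h ω, e⟫ ‖V + h ω‖² dν(ω) = ⟪V,e⟫ (‖V‖² + (5/3) h²)`. -/
theorem kick_average [IsProbabilityMeasure ν] (hν1 : ∀ᵐ ω ∂ν, ‖ω‖ = 1)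
    (hνs : ν.map (fun ω => -ω) = ν)
    (hνiso : ∀ e : V3, ∫ ω, ⟪ω, e⟫ ^ 2 ∂ν = ‖e‖ ^ 2 / 3) (V e : V3) (h : ℝ) :
    ∫ ω, ⟪V + h • ω, e⟫ * ‖V + h • ω‖ ^ 2 ∂ν = ⟪V, e⟫ * (‖V‖ ^ 2 + 5 / 3 * h ^ 2) := by
  -- a.e. on the sphere the integrand is a polynomial of degree ≤ 2 in `ω`
  have hae : (fun ω : V3 => ⟪V + h • ω, e⟫ * ‖V + h • ω‖ ^ 2) =ᵐ[ν] fun ω =>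
      ⟪V, e⟫ * (‖V‖ ^ 2 + h ^ 2) + 2 * h * ⟪V, e⟫ * ⟪ω, V⟫
        + h * (‖V‖ ^ 2 + h ^ 2) * ⟪ω, e⟫ + 2 * h ^ 2 * (⟪ω, e⟫ * ⟪ω, V⟫) := by
    filter_upwards [hν1] with ω hω
    have h1 : ‖V + h • ω‖ ^ 2 = ‖V‖ ^ 2 + 2 * h * ⟪ω, V⟫ + h ^ 2 := by
      rw [norm_add_sq_real, real_inner_smul_right, norm_smul, Real.norm_eq_abs, hω, mul_one,
        sq_abs, real_inner_comm V ω]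
      ring
    have h2 : ⟪V + h • ω, e⟫ = ⟪V, e⟫ + h * ⟪ω, e⟫ := by
      rw [inner_add_left, real_inner_smul_left]
    rw [h1, h2]
    ring
  rw [integral_congr_ae hae]
  have i0 : Integrable (fun _ : V3 => ⟪V, e⟫ * (‖V‖ ^ 2 + h ^ 2)) ν := integrable_const _
  have i1 : Integrable (fun ω : V3 => 2 * h * ⟪V, e⟫ * ⟪ω, V⟫) ν :=
    (integrable_inner_left hν1 V).const_mul _
  have i2 : Integrable (fun ω : V3 => h * (‖V‖ ^ 2 + h ^ 2) * ⟪ω, e⟫) ν :=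
    (integrable_inner_left hν1 e).const_mul _
  have i3 : Integrable (fun ω : V3 => 2 * h ^ 2 * (⟪ω, e⟫ * ⟪ω, V⟫)) ν :=
    (integrable_inner_mul_inner hν1 e V).const_mul _
  have i01 : Integrable (fun ω : V3 =>
      ⟪V, e⟫ * (‖V‖ ^ 2 + h ^ 2) + 2 * h * ⟪V, e⟫ * ⟪ω, V⟫) ν := i0.add i1
  have i012 : Integrable (fun ω : V3 =>
      ⟪V, e⟫ * (‖V‖ ^ 2 + h ^ 2) + 2 * h * ⟪V, e⟫ * ⟪ω, V⟫
        + h * (‖V‖ ^ 2 + h ^ 2) * ⟪ω, e⟫) ν := i01.add i2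
  rw [integral_add i012 i3, integral_add i01 i2, integral_add i0 i1]
  simp only [integral_const_mul, integral_const, probReal_univ, one_smul]
  rw [integral_inner_eq_zero hνs, integral_inner_eq_zero hνs, integral_inner_mul_inner hν1 hνiso,
    real_inner_comm V e]
  ring

/-! ### The `y` layer and the `x` layer -/

/-- Pointwise expansion of the kick-averaged pair heat flux as a cubic polynomial in `(x, y)`. -/
theorem pair_pointwise (x y e : V3) :
    ⟪(1 / 2 : ℝ) • (x + y), e⟫ * (‖(1 / 2 : ℝ) • (x + y)‖ ^ 2 + 5 / 3 * (‖x - y‖ / 2) ^ 2) =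
      1 / 3 * (⟪x, e⟫ * ‖x‖ ^ 2) + 1 / 3 * ⟪e, x⟫ * ‖y‖ ^ 2 + 1 / 3 * ‖x‖ ^ 2 * ⟪e, y⟫
        + 1 / 3 * (⟪y, e⟫ * ‖y‖ ^ 2) - 1 / 6 * ⟪e, x⟫ * ⟪x, y⟫
        - 1 / 6 * ⟪x, ⟪y, e⟫ • y⟫ := by
  have hn : ‖(1 / 2 : ℝ) • (x + y)‖ ^ 2 = 1 / 4 * (‖x‖ ^ 2 + 2 * ⟪x, y⟫ + ‖y‖ ^ 2) := by
    rw [norm_smul, mul_pow, Real.norm_eq_abs, abs_of_nonneg (by norm_num), norm_add_sq_real]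
    norm_num
  have hd : (‖x - y‖ / 2) ^ 2 = 1 / 4 * (‖x‖ ^ 2 - 2 * ⟪x, y⟫ + ‖y‖ ^ 2) := by
    rw [div_pow, norm_sub_sq_real]
    ring
  rw [hn, hd, real_inner_smul_left, inner_add_left, real_inner_smul_right, real_inner_comm x e,
    real_inner_comm y e]
  ring

variable {μ' : Measure V3}

/-- THE `y` LAYER: integrate the expansion of `pair_pointwise` against a centred probability law
with finite third moment. -/
theorem layer_y [IsProbabilityMeasure μ'] (h3 : Integrable (fun y : V3 => ‖y‖ ^ 3) μ')
    (h0 : ∫ y, y ∂μ' = 0) (x e : V3) :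
    ∫ y, ⟪(1 / 2 : ℝ) • (x + y), e⟫ *
        (‖(1 / 2 : ℝ) • (x + y)‖ ^ 2 + 5 / 3 * (‖x - y‖ / 2) ^ 2) ∂μ' =
      1 / 3 * (⟪x, e⟫ * ‖x‖ ^ 2) + (1 / 3 * ∫ y, ‖y‖ ^ 2 ∂μ') * ⟪e, x⟫
        + 1 / 3 * (∫ y, ⟪y, e⟫ * ‖y‖ ^ 2 ∂μ')
        - 1 / 6 * ⟪∫ y, ⟪y, e⟫ • y ∂μ', x⟫ := by
  simp_rw [pair_pointwise]
  have i0 : Integrable (fun _ : V3 => 1 / 3 * (⟪x, e⟫ * ‖x‖ ^ 2)) μ' := integrable_const _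
  have i1 : Integrable (fun y : V3 => 1 / 3 * ⟪e, x⟫ * ‖y‖ ^ 2) μ' :=
    (integrable_norm_sq h3).const_mul _
  have i2 : Integrable (fun y : V3 => 1 / 3 * ‖x‖ ^ 2 * ⟪e, y⟫) μ' :=
    ((integrable_self h3).const_inner (𝕜 := ℝ) e).const_mul _
  have i3 : Integrable (fun y : V3 => 1 / 3 * (⟪y, e⟫ * ‖y‖ ^ 2)) μ' :=
    (integrable_inner_mul_norm_sq h3 e).const_mul _
  have i4 : Integrable (fun y : V3 => 1 / 6 * ⟪e, x⟫ * ⟪x, y⟫) μ' :=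
    ((integrable_self h3).const_inner (𝕜 := ℝ) x).const_mul _
  have i5 : Integrable (fun y : V3 => 1 / 6 * ⟪x, ⟪y, e⟫ • y⟫) μ' :=
    ((integrable_inner_smul_self h3 e).const_inner (𝕜 := ℝ) x).const_mul _
  have i01 : Integrable (fun y : V3 =>
      1 / 3 * (⟪x, e⟫ * ‖x‖ ^ 2) + 1 / 3 * ⟪e, x⟫ * ‖y‖ ^ 2) μ' := i0.add i1
  have i012 : Integrable (fun y : V3 =>
      1 / 3 * (⟪x, e⟫ * ‖x‖ ^ 2) + 1 / 3 * ⟪e, x⟫ * ‖y‖ ^ 2 + 1 / 3 * ‖x‖ ^ 2 * ⟪e, y⟫) μ' :=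
    i01.add i2
  have i0123 : Integrable (fun y : V3 =>
      1 / 3 * (⟪x, e⟫ * ‖x‖ ^ 2) + 1 / 3 * ⟪e, x⟫ * ‖y‖ ^ 2 + 1 / 3 * ‖x‖ ^ 2 * ⟪e, y⟫
        + 1 / 3 * (⟪y, e⟫ * ‖y‖ ^ 2)) μ' := i012.add i3
  have i01234 : Integrable (fun y : V3 =>
      1 / 3 * (⟪x, e⟫ * ‖x‖ ^ 2) + 1 / 3 * ⟪e, x⟫ * ‖y‖ ^ 2 + 1 / 3 * ‖x‖ ^ 2 * ⟪e, y⟫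
        + 1 / 3 * (⟪y, e⟫ * ‖y‖ ^ 2) - 1 / 6 * ⟪e, x⟫ * ⟪x, y⟫) μ' := i0123.sub' i4
  rw [integral_sub i01234 i5, integral_sub i0123 i4, integral_add i012 i3, integral_add i01 i2,
    integral_add i0 i1]
  simp only [integral_const_mul, integral_const, probReal_univ, one_smul]
  rw [integral_inner (𝕜 := ℝ) (integrable_self h3) e,
    integral_inner (𝕜 := ℝ) (integrable_self h3) x,
    integral_inner (𝕜 := ℝ) (integrable_inner_smul_self h3 e) x, h0, inner_zero_right,
    inner_zero_right, real_inner_comm x (∫ y, ⟪y, e⟫ • y ∂μ')]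
  ring

/-- THE `x` LAYER: integrate the output of `layer_y` against a centred probability law with finite
third moment. -/
theorem layer_x [IsProbabilityMeasure μ] (h3 : Integrable (fun x : V3 => ‖x‖ ^ 3) μ)
    (h0 : ∫ x, x ∂μ = 0) (e w : V3) (M Q : ℝ) :
    ∫ x, (1 / 3 * (⟪x, e⟫ * ‖x‖ ^ 2) + 1 / 3 * M * ⟪e, x⟫ + 1 / 3 * Q
        - 1 / 6 * ⟪w, x⟫) ∂μ =
      ((∫ x, ⟪x, e⟫ * ‖x‖ ^ 2 ∂μ) + Q) / 3 := by
  have i0 : Integrable (fun x : V3 => 1 / 3 * (⟪x, e⟫ * ‖x‖ ^ 2)) μ :=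
    (integrable_inner_mul_norm_sq h3 e).const_mul _
  have i1 : Integrable (fun x : V3 => 1 / 3 * M * ⟪e, x⟫) μ :=
    ((integrable_self h3).const_inner (𝕜 := ℝ) e).const_mul _
  have i2 : Integrable (fun _ : V3 => 1 / 3 * Q) μ := integrable_const _
  have i3 : Integrable (fun x : V3 => 1 / 6 * ⟪w, x⟫) μ :=
    ((integrable_self h3).const_inner (𝕜 := ℝ) w).const_mul _
  have i01 : Integrable (fun x : V3 => 1 / 3 * (⟪x, e⟫ * ‖x‖ ^ 2) + 1 / 3 * M * ⟪e, x⟫) μ :=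
    i0.add i1
  have i012 : Integrable (fun x : V3 =>
      1 / 3 * (⟪x, e⟫ * ‖x‖ ^ 2) + 1 / 3 * M * ⟪e, x⟫ + 1 / 3 * Q) μ := i01.add i2
  rw [integral_sub i012 i3, integral_add i01 i2, integral_add i0 i1]
  simp only [integral_const_mul, integral_const, probReal_univ, one_smul]
  rw [integral_inner (𝕜 := ℝ) (integrable_self h3) e,
    integral_inner (𝕜 := ℝ) (integrable_self h3) w, h0, inner_zero_right, inner_zero_right]
  ring

end KacPair

open KacPair in
/-- `OneFlightGossipEngine.KacPairHeatFlux` (stmt-AtomisticToContinuum-9534) holds: one Kac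
collision damps the pair heat flux by `2/3` and splits it evenly,
`E[⟪x',e⟫ ‖x'‖²] = (E[⟪x,e⟫ ‖x‖²] + E[⟪y,e⟫ ‖y‖²]) / 3` for `x' = ½(x+y) + ½‖x−y‖ ω`.
Moment algebra of Ikenberry–Truesdell (1956) / Kac (1956). -/
theorem kacPairHeatFlux_proof : KacPairHeatFlux := by
  intro μ μ' ν _hμ _hμ' _hν hμ3 hμ'3 hμ0 hμ'0 hν1 hνs hνiso e
  have hω : ∀ x y : V3,
      ∫ ω, ⟪(1 / 2 : ℝ) • (x + y) + (‖x - y‖ / 2) • ω, e⟫ *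
          ‖(1 / 2 : ℝ) • (x + y) + (‖x - y‖ / 2) • ω‖ ^ 2 ∂ν =
        ⟪(1 / 2 : ℝ) • (x + y), e⟫ *
          (‖(1 / 2 : ℝ) • (x + y)‖ ^ 2 + 5 / 3 * (‖x - y‖ / 2) ^ 2) :=
    fun x y => kick_average hν1 hνs hνiso _ _ _
  simp_rw [hω, layer_y hμ'3 hμ'0]
  exact layer_x hμ3 hμ0 e _ _ _

end Summit.AtomisticToContinuum.HydrodynamicLimit.Theorems
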